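import Summits.ResolutionOfSingularities.ResolutionOfSingularities.Theorems.WeightedInvariantHypersurfaceCentreAssemblyPrimeT
import Summits.ResolutionOfSingularities.ResolutionOfSingularities.Theorems.AQSHeightTwoPlusStalkFactor
import Literature.AlgebraicGeometry.Resolution.CobordantBlowupRegular
import HarnessLib

/-!
# The local equation of the successor over the centre (ring level): `t⁻¹` is prime for a WEIGHTED SUB-r.s.p., primitive
# factorisation and principal strict transform for ANY presentation of the same filtration

Route `ResolutionOfSingularities/WeightedInvariant`, crux `Theses.WeightedInvariant.HypersurfaceCentreConstruction`
(stmt-ResolutionOfSingularities-19897), door line `local-engine`, E2 tier (S-b2-over) (res-L1-w43-plan-1 SPEC (Δ6b) rev 6, OFFER (o59-b2-over)):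
the local-equation clause `∃ a g, f = (t⁻¹)ᵃ g ∧ t⁻¹ ∤ g ∧ …` of `Stage.SuccOverCentreAt` quantifies over EVERY presentation `(u, w)` of the stalk
filtration of the centre, not only over regular systems of parameters; the chart of the centre only supplies a positively weighted family
`v` that is PART of an r.s.p. with `𝒥ₙ = (v^α : w·α ≥ n)`.

* `prime_cobordantT'_of_linearIndependent_toCotangent` — `t⁻¹` is prime in `S[t⁻¹, 𝒥ₙ tⁿ]` for a positively weighted family `v ⊆ 𝔪_S` with
  linearly independent differentials (`S` regular local) — the core of res-type-048's `prime_s_comp` (…CentreAssemblyPrimeT) WITHOUT the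
  ambient r.s.p. (Matsumura 14.2/14.3 + Włodarczyk §2.3.9 `S[t⁻¹, vⱼ t^{wⱼ}]/(t⁻¹) ≅ (S/(v))[X]`), transported to the game-side carrier along the
  bridge `exists_ringEquiv_extReesAlgebra_cobordantAlgebra`.
* `exists_factor_strictTransform_eq_of_presentation` — for ANY `(u, w)` with `(u^α : w·α ≥ n) = (v^β : w₁·β ≥ n)` for all `n` and `0 ≠ f ∈ S`:
  `f = (t⁻¹)ᵃ g₀`, `t⁻¹ ∤ g₀`, `σˢ((f)) = (g₀)` in `cobordantAlgebra' u w` (Krull: `f ∉ 𝔪^k ⊇ 𝒥_{kW}`; `exists_tInv_primitive_factorisation_weighted`;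
  `strictTransform_span_singleton_eq_of_factor`; primality transported along the equality of the filtrations).
Def-free; OURS bookkeeping; nothing here is a claim about Hironaka's problem; AI-written, weaker than expert review.
[cite: Wlodarczyk2022, §2.3.9 and 3.3.12; Matsumura1987, Thm. 14.2]
-/

noncomputable section

set_option linter.dupNamespace false -- mandated namespace of this single-conjunct summit

open scoped LaurentPolynomial
open LaurentPolynomial IsLocalRing
open Literature.AlgebraicGeometry.Resolution
open Summit.ResolutionOfSingularities.ResolutionOfSingularities.Theorems

namespace Summit.ResolutionOfSingularities.ResolutionOfSingularities.Cruxes.HypersurfaceCentreConstruction.LocalEngine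

section Prime

variable {S : Type} [CommRing S] [IsRegularLocalRing S] {m : ℕ} (v : Fin m → S) (w : Fin m → ℕ)

/-- **`t⁻¹` is prime in `S[t⁻¹, vⱼ t^{wⱼ}]` for a positively weighted family `v ⊆ 𝔪_S` with linearly independent differentials**
(`S` regular local): `S ⧸ (v)` is regular (Matsumura 14.2), hence a domain, and `S[t⁻¹, vⱼ t^{wⱼ}] ⧸ (t⁻¹) ≅ (S ⧸ (v))[X]` (Włodarczyk
§2.3.9).  res-type-048's `prime_s_comp` without the ambient regular system of parameters. [cite: Wlodarczyk2022, §2.3.9; Matsumura1987, Thm. 14.2] -/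
theorem prime_cobordantT'_of_linearIndependent_toCotangent (hpos : ∀ j, 0 < w j) (hv : ∀ j, v j ∈ maximalIdeal S)
    (hli : LinearIndependent (ResidueField S) fun j => (maximalIdeal S).toCotangent ⟨v j, hv j⟩) :
    Prime (cobordantT' v w) := by
  classical
  haveI : IsDomain S := isDomain_of_isRegularLocalRing S
  haveI : IsDomain (S ⧸ Ideal.span (Set.range v)) := by
    haveI := isRegularLocalRing_quotient_span_range v hv hli
    exact isDomain_of_isRegularLocalRing _
  have hwqr := weightedQuasiRegular_of_linearIndependent_toCotangent v w hpos hv hli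
  obtain ⟨e⟩ := cobordantAlgebra.nonempty_quotient_span_s_equiv v w hpos hwqr
  haveI : IsDomain (cobordantAlgebra v w ⧸ Ideal.span {cobordantAlgebra.s v w}) := e.toMulEquiv.isDomain
  have hs : Prime (cobordantAlgebra.s v w) := by
    rw [← Ideal.span_singleton_prime (nonZeroDivisors.ne_zero (cobordantAlgebra.s_mem_nonZeroDivisors v w))]
    exact (Ideal.Quotient.isDomain_iff_prime _).mp inferInstance
  -- transport to the game-side carrier
  obtain ⟨e', he'⟩ := exists_ringEquiv_extReesAlgebra_cobordantAlgebra v w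
  have hT : e' (cobordantT' v w) = cobordantAlgebra.s v w := ringEquiv_tInv_eq_s v w e' he'
  rw [← hT] at hs
  exact (MulEquiv.prime_iff e').mp hs

end Prime

/-! ## The factorisation for ANY presentation of the same filtration -/

section Factor

variable {S : Type} [CommRing S] [IsRegularLocalRing S] {n m : ℕ} (u : Fin n → S) (w : Fin n → ℕ)
  (v : Fin m → S) (w₁ : Fin m → ℕ)

/-- **Primitive factorisation and principal strict transform for ANY presentation.**  If `(u^α : w·α ≥ k) = (v^β : w₁·β ≥ k)` for every `k`,
where `v ⊆ 𝔪_S` is positively weighted with linearly independent differentials, and `f ≠ 0`, then in `S[t⁻¹, 𝒥ₖ tᵏ] = cobordantAlgebra' u w`: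
`f = (t⁻¹)ᵃ g₀`, `t⁻¹ ∤ g₀` and `σˢ((f)) = (g₀)`. [cite: Wlodarczyk2022, 3.3.12] -/
theorem exists_factor_strictTransform_eq_of_presentation (hpos : ∀ j, 0 < w₁ j) (hv : ∀ j, v j ∈ maximalIdeal S)
    (hli : LinearIndependent (ResidueField S) fun j => (maximalIdeal S).toCotangent ⟨v j, hv j⟩)
    (huv : ∀ k : ℕ, weightedMonomialIdeal u w k = weightedMonomialIdeal v w₁ k) {f : S} (hf : f ≠ 0) :
    ∃ (a : ℕ) (g₀ : cobordantAlgebra' u w),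
      algebraMap S (cobordantAlgebra' u w) f = cobordantT' u w ^ a * g₀ ∧ ¬ cobordantT' u w ∣ g₀ ∧
        extReesAlgebra.strictTransform (weightedMonomialIdeal u w) (Ideal.span {f}) = Ideal.span {g₀} := by
  classical
  haveI : IsDomain S := isDomain_of_isRegularLocalRing S
  -- `t⁻¹` is prime: transport from the presentation by `v`
  have hfun : weightedMonomialIdeal u w = weightedMonomialIdeal v w₁ := funext huv
  have hT : Prime (cobordantT' u w) := by
    have key : ∀ I : ℕ → Ideal S, I = weightedMonomialIdeal v w₁ → Prime (extReesAlgebra.tInv I) := by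
      rintro _ rfl
      exact prime_cobordantT'_of_linearIndependent_toCotangent v w₁ hpos hv hli
    exact key _ hfun
  -- `f ∉ 𝒥_N` for some `N` (Krull: `𝒥_{kW} ⊆ 𝔪ᵏ`)
  obtain ⟨N, hN⟩ : ∃ N : ℕ, f ∉ weightedMonomialIdeal u w N := by
    set W : ℕ := Finset.univ.sup w₁ + 1 with hW
    have hWle : ∀ j, w₁ j ≤ W := fun j => (Finset.le_sup (Finset.mem_univ j)).trans (Nat.le_succ _)
    have hWpos : 0 < W := Nat.succ_pos _
    obtain ⟨k, hk⟩ : ∃ k : ℕ, f ∉ maximalIdeal S ^ k := by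
      by_contra h
      push Not at h
      have hmem : f ∈ ⨅ k : ℕ, maximalIdeal S ^ k := Ideal.mem_iInf.mpr h
      rw [Ideal.iInf_pow_eq_bot_of_isLocalRing _ (maximalIdeal.isMaximal S).ne_top] at hmem
      exact hf hmem
    refine ⟨k * W, fun hmem => hk ?_⟩
    have hle := AQSHeightTwo.weightedMonomialIdeal_le_maximalIdeal_pow_div hv hWle (k * W)
    rw [Nat.mul_div_cancel _ hWpos] at hle
    exact hle (huv (k * W) ▸ hmem)
  obtain ⟨a, g₀, -, -, -, hfg, hndvd⟩ := AQSHeightTwo.exists_tInv_primitive_factorisation_weighted u w hN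
  exact ⟨a, g₀, hfg, hndvd, strictTransform_span_singleton_eq_of_factor u w hT hfg hndvd⟩

end Factor

end Summit.ResolutionOfSingularities.ResolutionOfSingularities.Cruxes.HypersurfaceCentreConstruction.LocalEngine

end
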